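import Mathlib
import Summits.Ventures.PercRepro2.OneEdge
import Summits.Ventures.PercRepro2.TypedMarkedSeriesDefs
import Summits.Ventures.PercRepro2.TypedMarkedSeriesGraph
import Summits.Ventures.PercRepro2.TypedMarkedSeriesStateA
import Summits.Ventures.PercRepro2.TypedMarkedSeriesPos
import Summits.Ventures.PercRepro2.TypedCoincRootEdge

/-!
# The state lemma of the marked star `o ~ {a₁, b, a₃}` (blind cell PercRepro2, night-3 g14,
2026-08-27; `proofs/NIGHT3-CERT.md` §23.12)

`st_modelU`: when `o` carries exactly the edges `e = {a₁, o}` (bit `p`), `f = {o, b}` (bit `a`) and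
`g = {o, a₃}` (bit `u`), the state of `x[e ↦ p][f ↦ a][g ↦ u]` is an explicit Boolean function of the
signature of `x`: with `g` closed it is rule F's model (`st_swap_b3` + `st_modelA` for the marks with
`b ↔ a₃` exchanged); opening `g` joins the cluster of `o` with that of `a₃` (`conn_update_true_iff`).
Nothing here asserts anything about the original lane.
-/

namespace Summit.Ventures.PercRepro2

open UnionCluster

namespace CovForm

namespace MarkedSeries

open OneTyped TypedA3 Untouched TypedRed

section StateLemma

open Classical

variable {V : Type*} {E : Type*} [DecidableEq E]
variable (ends : E → Sym2 V) (o a₁ a₂ a₃ b : V)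

/-- **State lemma U**: `o` with exactly the edges `e = {a₁, o}`, `f = {o, b}`, `g = {o, a₃}`. -/
lemma st_modelU {e f g : E} (hef : e ≠ f) (heg : e ≠ g) (hfg : f ≠ g) (he : ends e = s(a₁, o))
    (hf : ends f = s(o, b)) (hg : ends g = s(o, a₃)) (ho1 : o ≠ a₁) (ho2 : o ≠ a₂) (ho3 : o ≠ a₃)
    (hob : o ≠ b) (x : Config E) (hxe : x e = false) (hxf : x f = false) (hxg : x g = false)
    (hother : ∀ e', e' ≠ e → e' ≠ f → e' ≠ g → o ∈ ends e' → x e' = false) (p a u : Bool) :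
    st ends o a₁ a₂ a₃ b (Function.update (Function.update (Function.update x e p) f a) g u) =
      (if u then ((St.q' ((modelA (decide (Conn ends x a₁ a₂)) (decide (Conn ends x a₁ a₃)) (decide (Conn ends x a₁ b)) (decide (Conn ends x a₂ a₃)) (decide (Conn ends x a₂ b)) (decide (Conn ends x a₃ b)) p a).1, (modelA (decide (Conn ends x a₁ a₂)) (decide (Conn ends x a₁ a₃)) (decide (Conn ends x a₁ b)) (decide (Conn ends x a₂ a₃)) (decide (Conn ends x a₂ b)) (decide (Conn ends x a₃ b)) p a).2.1, (modelA (decide (Conn ends x a₁ a₂)) (decide (Conn ends x a₁ a₃)) (decide (Conn ends x a₁ b)) (decide (Conn ends x a₂ a₃)) (decide (Conn ends x a₂ b)) (decide (Conn ends x a₃ b)) p a).2.2.1, (modelA (decide (Conn ends x a₁ a₂)) (decide (Conn ends x a₁ a₃)) (decide (Conn ends x a₁ b)) (decide (Conn ends x a₂ a₃)) (decide (Conn ends x a₂ b)) (decide (Conn ends x a₃ b)) p a).2.2.2.2.2.1, (modelA (decide (Conn ends x a₁ a₂)) (decide (Conn ends x a₁ a₃)) (decide (Conn ends x a₁ b))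 (decide (Conn ends x a₂ a₃)) (decide (Conn ends x a₂ b)) (decide (Conn ends x a₃ b)) p a).2.2.2.2.2.2, (modelA (decide (Conn ends x a₁ a₂)) (decide (Conn ends x a₁ a₃)) (decide (Conn ends x a₁ b)) (decide (Conn ends x a₂ a₃)) (decide (Conn ends x a₂ b)) (decide (Conn ends x a₃ b)) p a).2.2.2.1, (modelA (decide (Conn ends x a₁ a₂)) (decide (Conn ends x a₁ a₃)) (decide (Conn ends x a₁ b)) (decide (Conn ends x a₂ a₃)) (decide (Conn ends x a₂ b)) (decide (Conn ends x a₃ b)) p a).2.2.2.2.1)) || ((St.Ho ((modelA (decide (Conn ends x a₁ a₂)) (decide (Conn ends x a₁ a₃)) (decide (Conn ends x a₁ b)) (decide (Conn ends x a₂ a₃)) (decide (Conn ends x a₂ b)) (decide (Conn ends x a₃ b)) p a).1, (modelA (decide (Conn ends x a₁ a₂)) (decide (Conn ends x a₁ a₃)) (decide (Conn ends x a₁ b)) (decide (Conn ends x a₂ a₃)) (decide (Conn ends x a₂ b)) (decide (Conn ends x a₃ b)) p a).2.1, (modelA (decide (Conn ends x a₁ a₂)) (decide (Conn ends x a₁ a₃))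 (decide (Conn ends x a₁ b)) (decide (Conn ends x a₂ a₃)) (decide (Conn ends x a₂ b)) (decide (Conn ends x a₃ b)) p a).2.2.1, (modelA (decide (Conn ends x a₁ a₂)) (decide (Conn ends x a₁ a₃)) (decide (Conn ends x a₁ b)) (decide (Conn ends x a₂ a₃)) (decide (Conn ends x a₂ b)) (decide (Conn ends x a₃ b)) p a).2.2.2.2.2.1, (modelA (decide (Conn ends x a₁ a₂)) (decide (Conn ends x a₁ a₃)) (decide (Conn ends x a₁ b)) (decide (Conn ends x a₂ a₃)) (decide (Conn ends x a₂ b)) (decide (Conn ends x a₃ b)) p a).2.2.2.2.2.2, (modelA (decide (Conn ends x a₁ a₂)) (decide (Conn ends x a₁ a₃)) (decide (Conn ends x a₁ b)) (decide (Conn ends x a₂ a₃)) (decide (Conn ends x a₂ b)) (decide (Conn ends x a₃ b)) p a).2.2.2.1, (modelA (decide (Conn ends x a₁ a₂)) (decide (Conn ends x a₁ a₃)) (decide (Conn ends x a₁ b)) (decide (Conn ends x a₂ a₃)) (decide (Conn ends x a₂ b)) (decide (Conn ends x a₃ b)) p a).2.2.2.2.1)) && (St.L3 ((modelA (decide (Conn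 ends x a₁ a₂)) (decide (Conn ends x a₁ a₃)) (decide (Conn ends x a₁ b)) (decide (Conn ends x a₂ a₃)) (decide (Conn ends x a₂ b)) (decide (Conn ends x a₃ b)) p a).1, (modelA (decide (Conn ends x a₁ a₂)) (decide (Conn ends x a₁ a₃)) (decide (Conn ends x a₁ b)) (decide (Conn ends x a₂ a₃)) (decide (Conn ends x a₂ b)) (decide (Conn ends x a₃ b)) p a).2.1, (modelA (decide (Conn ends x a₁ a₂)) (decide (Conn ends x a₁ a₃)) (decide (Conn ends x a₁ b)) (decide (Conn ends x a₂ a₃)) (decide (Conn ends x a₂ b)) (decide (Conn ends x a₃ b)) p a).2.2.1, (modelA (decide (Conn ends x a₁ a₂)) (decide (Conn ends x a₁ a₃)) (decide (Conn ends x a₁ b)) (decide (Conn ends x a₂ a₃)) (decide (Conn ends x a₂ b)) (decide (Conn ends x a₃ b)) p a).2.2.2.2.2.1, (modelA (decide (Conn ends x a₁ a₂)) (decide (Conn ends x a₁ a₃)) (decide (Conn ends x a₁ b)) (decide (Conn ends x a₂ a₃)) (decide (Conn ends x a₂ b)) (decide (Conn ends x a₃ b)) p a).2.2.2.2.2.2,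 (modelA (decide (Conn ends x a₁ a₂)) (decide (Conn ends x a₁ a₃)) (decide (Conn ends x a₁ b)) (decide (Conn ends x a₂ a₃)) (decide (Conn ends x a₂ b)) (decide (Conn ends x a₃ b)) p a).2.2.2.1, (modelA (decide (Conn ends x a₁ a₂)) (decide (Conn ends x a₁ a₃)) (decide (Conn ends x a₁ b)) (decide (Conn ends x a₂ a₃)) (decide (Conn ends x a₂ b)) (decide (Conn ends x a₃ b)) p a).2.2.2.2.1))) || ((St.H3 ((modelA (decide (Conn ends x a₁ a₂)) (decide (Conn ends x a₁ a₃)) (decide (Conn ends x a₁ b)) (decide (Conn ends x a₂ a₃)) (decide (Conn ends x a₂ b)) (decide (Conn ends x a₃ b)) p a).1, (modelA (decide (Conn ends x a₁ a₂)) (decide (Conn ends x a₁ a₃)) (decide (Conn ends x a₁ b)) (decide (Conn ends x a₂ a₃)) (decide (Conn ends x a₂ b)) (decide (Conn ends x a₃ b)) p a).2.1, (modelA (decide (Conn ends x a₁ a₂)) (decide (Conn ends x a₁ a₃)) (decide (Conn ends x a₁ b)) (decide (Conn ends x a₂ a₃)) (decide (Conn ends x a₂ b)) (decide (Conn ends x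 a₃ b)) p a).2.2.1, (modelA (decide (Conn ends x a₁ a₂)) (decide (Conn ends x a₁ a₃)) (decide (Conn ends x a₁ b)) (decide (Conn ends x a₂ a₃)) (decide (Conn ends x a₂ b)) (decide (Conn ends x a₃ b)) p a).2.2.2.2.2.1, (modelA (decide (Conn ends x a₁ a₂)) (decide (Conn ends x a₁ a₃)) (decide (Conn ends x a₁ b)) (decide (Conn ends x a₂ a₃)) (decide (Conn ends x a₂ b)) (decide (Conn ends x a₃ b)) p a).2.2.2.2.2.2, (modelA (decide (Conn ends x a₁ a₂)) (decide (Conn ends x a₁ a₃)) (decide (Conn ends x a₁ b)) (decide (Conn ends x a₂ a₃)) (decide (Conn ends x a₂ b)) (decide (Conn ends x a₃ b)) p a).2.2.2.1, (modelA (decide (Conn ends x a₁ a₂)) (decide (Conn ends x a₁ a₃)) (decide (Conn ends x a₁ b)) (decide (Conn ends x a₂ a₃)) (decide (Conn ends x a₂ b)) (decide (Conn ends x a₃ b)) p a).2.2.2.2.1)) && (St.Lo ((modelA (decide (Conn ends x a₁ a₂)) (decide (Conn ends x a₁ a₃)) (decide (Conn ends x a₁ b)) (decide (Conn ends x a₂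 a₃)) (decide (Conn ends x a₂ b)) (decide (Conn ends x a₃ b)) p a).1, (modelA (decide (Conn ends x a₁ a₂)) (decide (Conn ends x a₁ a₃)) (decide (Conn ends x a₁ b)) (decide (Conn ends x a₂ a₃)) (decide (Conn ends x a₂ b)) (decide (Conn ends x a₃ b)) p a).2.1, (modelA (decide (Conn ends x a₁ a₂)) (decide (Conn ends x a₁ a₃)) (decide (Conn ends x a₁ b)) (decide (Conn ends x a₂ a₃)) (decide (Conn ends x a₂ b)) (decide (Conn ends x a₃ b)) p a).2.2.1, (modelA (decide (Conn ends x a₁ a₂)) (decide (Conn ends x a₁ a₃)) (decide (Conn ends x a₁ b)) (decide (Conn ends x a₂ a₃)) (decide (Conn ends x a₂ b)) (decide (Conn ends x a₃ b)) p a).2.2.2.2.2.1, (modelA (decide (Conn ends x a₁ a₂)) (decide (Conn ends x a₁ a₃)) (decide (Conn ends x a₁ b)) (decide (Conn ends x a₂ a₃)) (decide (Conn ends x a₂ b)) (decide (Conn ends x a₃ b)) p a).2.2.2.2.2.2, (modelA (decide (Conn ends x a₁ a₂)) (decide (Conn ends x a₁ a₃)) (decide (Conn ends x a₁ b)) (decide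 (Conn ends x a₂ a₃)) (decide (Conn ends x a₂ b)) (decide (Conn ends x a₃ b)) p a).2.2.2.1, (modelA (decide (Conn ends x a₁ a₂)) (decide (Conn ends x a₁ a₃)) (decide (Conn ends x a₁ b)) (decide (Conn ends x a₂ a₃)) (decide (Conn ends x a₂ b)) (decide (Conn ends x a₃ b)) p a).2.2.2.2.1))), (St.Lo ((modelA (decide (Conn ends x a₁ a₂)) (decide (Conn ends x a₁ a₃)) (decide (Conn ends x a₁ b)) (decide (Conn ends x a₂ a₃)) (decide (Conn ends x a₂ b)) (decide (Conn ends x a₃ b)) p a).1, (modelA (decide (Conn ends x a₁ a₂)) (decide (Conn ends x a₁ a₃)) (decide (Conn ends x a₁ b)) (decide (Conn ends x a₂ a₃)) (decide (Conn ends x a₂ b)) (decide (Conn ends x a₃ b)) p a).2.1, (modelA (decide (Conn ends x a₁ a₂)) (decide (Conn ends x a₁ a₃)) (decide (Conn ends x a₁ b)) (decide (Conn ends x a₂ a₃)) (decide (Conn ends x a₂ b)) (decide (Conn ends x a₃ b)) p a).2.2.1, (modelA (decide (Conn ends x a₁ a₂)) (decide (Conn ends x a₁ a₃)) (decide (Conn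 ends x a₁ b)) (decide (Conn ends x a₂ a₃)) (decide (Conn ends x a₂ b)) (decide (Conn ends x a₃ b)) p a).2.2.2.2.2.1, (modelA (decide (Conn ends x a₁ a₂)) (decide (Conn ends x a₁ a₃)) (decide (Conn ends x a₁ b)) (decide (Conn ends x a₂ a₃)) (decide (Conn ends x a₂ b)) (decide (Conn ends x a₃ b)) p a).2.2.2.2.2.2, (modelA (decide (Conn ends x a₁ a₂)) (decide (Conn ends x a₁ a₃)) (decide (Conn ends x a₁ b)) (decide (Conn ends x a₂ a₃)) (decide (Conn ends x a₂ b)) (decide (Conn ends x a₃ b)) p a).2.2.2.1, (modelA (decide (Conn ends x a₁ a₂)) (decide (Conn ends x a₁ a₃)) (decide (Conn ends x a₁ b)) (decide (Conn ends x a₂ a₃)) (decide (Conn ends x a₂ b)) (decide (Conn ends x a₃ b)) p a).2.2.2.2.1)) || (St.L3 ((modelA (decide (Conn ends x a₁ a₂)) (decide (Conn ends x a₁ a₃)) (decide (Conn ends x a₁ b)) (decide (Conn ends x a₂ a₃)) (decide (Conn ends x a₂ b)) (decide (Conn ends x a₃ b)) p a).1, (modelA (decide (Conn ends x a₁ a₂))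 (decide (Conn ends x a₁ a₃)) (decide (Conn ends x a₁ b)) (decide (Conn ends x a₂ a₃)) (decide (Conn ends x a₂ b)) (decide (Conn ends x a₃ b)) p a).2.1, (modelA (decide (Conn ends x a₁ a₂)) (decide (Conn ends x a₁ a₃)) (decide (Conn ends x a₁ b)) (decide (Conn ends x a₂ a₃)) (decide (Conn ends x a₂ b)) (decide (Conn ends x a₃ b)) p a).2.2.1, (modelA (decide (Conn ends x a₁ a₂)) (decide (Conn ends x a₁ a₃)) (decide (Conn ends x a₁ b)) (decide (Conn ends x a₂ a₃)) (decide (Conn ends x a₂ b)) (decide (Conn ends x a₃ b)) p a).2.2.2.2.2.1, (modelA (decide (Conn ends x a₁ a₂)) (decide (Conn ends x a₁ a₃)) (decide (Conn ends x a₁ b)) (decide (Conn ends x a₂ a₃)) (decide (Conn ends x a₂ b)) (decide (Conn ends x a₃ b)) p a).2.2.2.2.2.2, (modelA (decide (Conn ends x a₁ a₂)) (decide (Conn ends x a₁ a₃)) (decide (Conn ends x a₁ b)) (decide (Conn ends x a₂ a₃)) (decide (Conn ends x a₂ b)) (decide (Conn ends x a₃ b)) p a).2.2.2.1, (modelA (decide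 (Conn ends x a₁ a₂)) (decide (Conn ends x a₁ a₃)) (decide (Conn ends x a₁ b)) (decide (Conn ends x a₂ a₃)) (decide (Conn ends x a₂ b)) (decide (Conn ends x a₃ b)) p a).2.2.2.2.1)), (St.Ho ((modelA (decide (Conn ends x a₁ a₂)) (decide (Conn ends x a₁ a₃)) (decide (Conn ends x a₁ b)) (decide (Conn ends x a₂ a₃)) (decide (Conn ends x a₂ b)) (decide (Conn ends x a₃ b)) p a).1, (modelA (decide (Conn ends x a₁ a₂)) (decide (Conn ends x a₁ a₃)) (decide (Conn ends x a₁ b)) (decide (Conn ends x a₂ a₃)) (decide (Conn ends x a₂ b)) (decide (Conn ends x a₃ b)) p a).2.1, (modelA (decide (Conn ends x a₁ a₂)) (decide (Conn ends x a₁ a₃)) (decide (Conn ends x a₁ b)) (decide (Conn ends x a₂ a₃)) (decide (Conn ends x a₂ b)) (decide (Conn ends x a₃ b)) p a).2.2.1, (modelA (decide (Conn ends x a₁ a₂)) (decide (Conn ends x a₁ a₃)) (decide (Conn ends x a₁ b)) (decide (Conn ends x a₂ a₃)) (decide (Conn ends x a₂ b)) (decide (Conn ends x a₃ b)) p a).2.2.2.2.2.1,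 (modelA (decide (Conn ends x a₁ a₂)) (decide (Conn ends x a₁ a₃)) (decide (Conn ends x a₁ b)) (decide (Conn ends x a₂ a₃)) (decide (Conn ends x a₂ b)) (decide (Conn ends x a₃ b)) p a).2.2.2.2.2.2, (modelA (decide (Conn ends x a₁ a₂)) (decide (Conn ends x a₁ a₃)) (decide (Conn ends x a₁ b)) (decide (Conn ends x a₂ a₃)) (decide (Conn ends x a₂ b)) (decide (Conn ends x a₃ b)) p a).2.2.2.1, (modelA (decide (Conn ends x a₁ a₂)) (decide (Conn ends x a₁ a₃)) (decide (Conn ends x a₁ b)) (decide (Conn ends x a₂ a₃)) (decide (Conn ends x a₂ b)) (decide (Conn ends x a₃ b)) p a).2.2.2.2.1)) || (St.H3 ((modelA (decide (Conn ends x a₁ a₂)) (decide (Conn ends x a₁ a₃)) (decide (Conn ends x a₁ b)) (decide (Conn ends x a₂ a₃)) (decide (Conn ends x a₂ b)) (decide (Conn ends x a₃ b)) p a).1, (modelA (decide (Conn ends x a₁ a₂)) (decide (Conn ends x a₁ a₃)) (decide (Conn ends x a₁ b)) (decide (Conn ends x a₂ a₃)) (decide (Conn ends x a₂ b)) (decide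 (Conn ends x a₃ b)) p a).2.1, (modelA (decide (Conn ends x a₁ a₂)) (decide (Conn ends x a₁ a₃)) (decide (Conn ends x a₁ b)) (decide (Conn ends x a₂ a₃)) (decide (Conn ends x a₂ b)) (decide (Conn ends x a₃ b)) p a).2.2.1, (modelA (decide (Conn ends x a₁ a₂)) (decide (Conn ends x a₁ a₃)) (decide (Conn ends x a₁ b)) (decide (Conn ends x a₂ a₃)) (decide (Conn ends x a₂ b)) (decide (Conn ends x a₃ b)) p a).2.2.2.2.2.1, (modelA (decide (Conn ends x a₁ a₂)) (decide (Conn ends x a₁ a₃)) (decide (Conn ends x a₁ b)) (decide (Conn ends x a₂ a₃)) (decide (Conn ends x a₂ b)) (decide (Conn ends x a₃ b)) p a).2.2.2.2.2.2, (modelA (decide (Conn ends x a₁ a₂)) (decide (Conn ends x a₁ a₃)) (decide (Conn ends x a₁ b)) (decide (Conn ends x a₂ a₃)) (decide (Conn ends x a₂ b)) (decide (Conn ends x a₃ b)) p a).2.2.2.1, (modelA (decide (Conn ends x a₁ a₂)) (decide (Conn ends x a₁ a₃)) (decide (Conn ends x a₁ b)) (decide (Conn ends x a₂ a₃)) (decide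 (Conn ends x a₂ b)) (decide (Conn ends x a₃ b)) p a).2.2.2.2.1)), (St.Lb ((modelA (decide (Conn ends x a₁ a₂)) (decide (Conn ends x a₁ a₃)) (decide (Conn ends x a₁ b)) (decide (Conn ends x a₂ a₃)) (decide (Conn ends x a₂ b)) (decide (Conn ends x a₃ b)) p a).1, (modelA (decide (Conn ends x a₁ a₂)) (decide (Conn ends x a₁ a₃)) (decide (Conn ends x a₁ b)) (decide (Conn ends x a₂ a₃)) (decide (Conn ends x a₂ b)) (decide (Conn ends x a₃ b)) p a).2.1, (modelA (decide (Conn ends x a₁ a₂)) (decide (Conn ends x a₁ a₃)) (decide (Conn ends x a₁ b)) (decide (Conn ends x a₂ a₃)) (decide (Conn ends x a₂ b)) (decide (Conn ends x a₃ b)) p a).2.2.1, (modelA (decide (Conn ends x a₁ a₂)) (decide (Conn ends x a₁ a₃)) (decide (Conn ends x a₁ b)) (decide (Conn ends x a₂ a₃)) (decide (Conn ends x a₂ b)) (decide (Conn ends x a₃ b)) p a).2.2.2.2.2.1, (modelA (decide (Conn ends x a₁ a₂)) (decide (Conn ends x a₁ a₃)) (decide (Conn ends x a₁ b)) (decide (Conn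 ends x a₂ a₃)) (decide (Conn ends x a₂ b)) (decide (Conn ends x a₃ b)) p a).2.2.2.2.2.2, (modelA (decide (Conn ends x a₁ a₂)) (decide (Conn ends x a₁ a₃)) (decide (Conn ends x a₁ b)) (decide (Conn ends x a₂ a₃)) (decide (Conn ends x a₂ b)) (decide (Conn ends x a₃ b)) p a).2.2.2.1, (modelA (decide (Conn ends x a₁ a₂)) (decide (Conn ends x a₁ a₃)) (decide (Conn ends x a₁ b)) (decide (Conn ends x a₂ a₃)) (decide (Conn ends x a₂ b)) (decide (Conn ends x a₃ b)) p a).2.2.2.2.1)) || ((St.Lo ((modelA (decide (Conn ends x a₁ a₂)) (decide (Conn ends x a₁ a₃)) (decide (Conn ends x a₁ b)) (decide (Conn ends x a₂ a₃)) (decide (Conn ends x a₂ b)) (decide (Conn ends x a₃ b)) p a).1, (modelA (decide (Conn ends x a₁ a₂)) (decide (Conn ends x a₁ a₃)) (decide (Conn ends x a₁ b)) (decide (Conn ends x a₂ a₃)) (decide (Conn ends x a₂ b)) (decide (Conn ends x a₃ b)) p a).2.1, (modelA (decide (Conn ends x a₁ a₂)) (decide (Conn ends x a₁ a₃)) (decide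 (Conn ends x a₁ b)) (decide (Conn ends x a₂ a₃)) (decide (Conn ends x a₂ b)) (decide (Conn ends x a₃ b)) p a).2.2.1, (modelA (decide (Conn ends x a₁ a₂)) (decide (Conn ends x a₁ a₃)) (decide (Conn ends x a₁ b)) (decide (Conn ends x a₂ a₃)) (decide (Conn ends x a₂ b)) (decide (Conn ends x a₃ b)) p a).2.2.2.2.2.1, (modelA (decide (Conn ends x a₁ a₂)) (decide (Conn ends x a₁ a₃)) (decide (Conn ends x a₁ b)) (decide (Conn ends x a₂ a₃)) (decide (Conn ends x a₂ b)) (decide (Conn ends x a₃ b)) p a).2.2.2.2.2.2, (modelA (decide (Conn ends x a₁ a₂)) (decide (Conn ends x a₁ a₃)) (decide (Conn ends x a₁ b)) (decide (Conn ends x a₂ a₃)) (decide (Conn ends x a₂ b)) (decide (Conn ends x a₃ b)) p a).2.2.2.1, (modelA (decide (Conn ends x a₁ a₂)) (decide (Conn ends x a₁ a₃)) (decide (Conn ends x a₁ b)) (decide (Conn ends x a₂ a₃)) (decide (Conn ends x a₂ b)) (decide (Conn ends x a₃ b)) p a).2.2.2.2.1)) && (decide (Conn ends x a₃ b) || (p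 && a && (decide (Conn ends x a₁ a₃) || decide (Conn ends x a₃ b))))) || ((St.L3 ((modelA (decide (Conn ends x a₁ a₂)) (decide (Conn ends x a₁ a₃)) (decide (Conn ends x a₁ b)) (decide (Conn ends x a₂ a₃)) (decide (Conn ends x a₂ b)) (decide (Conn ends x a₃ b)) p a).1, (modelA (decide (Conn ends x a₁ a₂)) (decide (Conn ends x a₁ a₃)) (decide (Conn ends x a₁ b)) (decide (Conn ends x a₂ a₃)) (decide (Conn ends x a₂ b)) (decide (Conn ends x a₃ b)) p a).2.1, (modelA (decide (Conn ends x a₁ a₂)) (decide (Conn ends x a₁ a₃)) (decide (Conn ends x a₁ b)) (decide (Conn ends x a₂ a₃)) (decide (Conn ends x a₂ b)) (decide (Conn ends x a₃ b)) p a).2.2.1, (modelA (decide (Conn ends x a₁ a₂)) (decide (Conn ends x a₁ a₃)) (decide (Conn ends x a₁ b)) (decide (Conn ends x a₂ a₃)) (decide (Conn ends x a₂ b)) (decide (Conn ends x a₃ b)) p a).2.2.2.2.2.1, (modelA (decide (Conn ends x a₁ a₂)) (decide (Conn ends x a₁ a₃)) (decide (Conn ends x a₁ b)) (decide (Conn ends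 x a₂ a₃)) (decide (Conn ends x a₂ b)) (decide (Conn ends x a₃ b)) p a).2.2.2.2.2.2, (modelA (decide (Conn ends x a₁ a₂)) (decide (Conn ends x a₁ a₃)) (decide (Conn ends x a₁ b)) (decide (Conn ends x a₂ a₃)) (decide (Conn ends x a₂ b)) (decide (Conn ends x a₃ b)) p a).2.2.2.1, (modelA (decide (Conn ends x a₁ a₂)) (decide (Conn ends x a₁ a₃)) (decide (Conn ends x a₁ b)) (decide (Conn ends x a₂ a₃)) (decide (Conn ends x a₂ b)) (decide (Conn ends x a₃ b)) p a).2.2.2.2.1)) && ((p && (St.Lb ((modelA (decide (Conn ends x a₁ a₂)) (decide (Conn ends x a₁ a₃)) (decide (Conn ends x a₁ b)) (decide (Conn ends x a₂ a₃)) (decide (Conn ends x a₂ b)) (decide (Conn ends x a₃ b)) p a).1, (modelA (decide (Conn ends x a₁ a₂)) (decide (Conn ends x a₁ a₃)) (decide (Conn ends x a₁ b)) (decide (Conn ends x a₂ a₃)) (decide (Conn ends x a₂ b)) (decide (Conn ends x a₃ b)) p a).2.1, (modelA (decide (Conn ends x a₁ a₂)) (decide (Conn ends x a₁ a₃)) (decide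 (Conn ends x a₁ b)) (decide (Conn ends x a₂ a₃)) (decide (Conn ends x a₂ b)) (decide (Conn ends x a₃ b)) p a).2.2.1, (modelA (decide (Conn ends x a₁ a₂)) (decide (Conn ends x a₁ a₃)) (decide (Conn ends x a₁ b)) (decide (Conn ends x a₂ a₃)) (decide (Conn ends x a₂ b)) (decide (Conn ends x a₃ b)) p a).2.2.2.2.2.1, (modelA (decide (Conn ends x a₁ a₂)) (decide (Conn ends x a₁ a₃)) (decide (Conn ends x a₁ b)) (decide (Conn ends x a₂ a₃)) (decide (Conn ends x a₂ b)) (decide (Conn ends x a₃ b)) p a).2.2.2.2.2.2, (modelA (decide (Conn ends x a₁ a₂)) (decide (Conn ends x a₁ a₃)) (decide (Conn ends x a₁ b)) (decide (Conn ends x a₂ a₃)) (decide (Conn ends x a₂ b)) (decide (Conn ends x a₃ b)) p a).2.2.2.1, (modelA (decide (Conn ends x a₁ a₂)) (decide (Conn ends x a₁ a₃)) (decide (Conn ends x a₁ b)) (decide (Conn ends x a₂ a₃)) (decide (Conn ends x a₂ b)) (decide (Conn ends x a₃ b)) p a).2.2.2.2.1))) || a)), (St.Hb ((modelA (decide (Conn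 ends x a₁ a₂)) (decide (Conn ends x a₁ a₃)) (decide (Conn ends x a₁ b)) (decide (Conn ends x a₂ a₃)) (decide (Conn ends x a₂ b)) (decide (Conn ends x a₃ b)) p a).1, (modelA (decide (Conn ends x a₁ a₂)) (decide (Conn ends x a₁ a₃)) (decide (Conn ends x a₁ b)) (decide (Conn ends x a₂ a₃)) (decide (Conn ends x a₂ b)) (decide (Conn ends x a₃ b)) p a).2.1, (modelA (decide (Conn ends x a₁ a₂)) (decide (Conn ends x a₁ a₃)) (decide (Conn ends x a₁ b)) (decide (Conn ends x a₂ a₃)) (decide (Conn ends x a₂ b)) (decide (Conn ends x a₃ b)) p a).2.2.1, (modelA (decide (Conn ends x a₁ a₂)) (decide (Conn ends x a₁ a₃)) (decide (Conn ends x a₁ b)) (decide (Conn ends x a₂ a₃)) (decide (Conn ends x a₂ b)) (decide (Conn ends x a₃ b)) p a).2.2.2.2.2.1, (modelA (decide (Conn ends x a₁ a₂)) (decide (Conn ends x a₁ a₃)) (decide (Conn ends x a₁ b)) (decide (Conn ends x a₂ a₃)) (decide (Conn ends x a₂ b)) (decide (Conn ends x a₃ b)) p a).2.2.2.2.2.2,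 (modelA (decide (Conn ends x a₁ a₂)) (decide (Conn ends x a₁ a₃)) (decide (Conn ends x a₁ b)) (decide (Conn ends x a₂ a₃)) (decide (Conn ends x a₂ b)) (decide (Conn ends x a₃ b)) p a).2.2.2.1, (modelA (decide (Conn ends x a₁ a₂)) (decide (Conn ends x a₁ a₃)) (decide (Conn ends x a₁ b)) (decide (Conn ends x a₂ a₃)) (decide (Conn ends x a₂ b)) (decide (Conn ends x a₃ b)) p a).2.2.2.2.1)) || ((St.Ho ((modelA (decide (Conn ends x a₁ a₂)) (decide (Conn ends x a₁ a₃)) (decide (Conn ends x a₁ b)) (decide (Conn ends x a₂ a₃)) (decide (Conn ends x a₂ b)) (decide (Conn ends x a₃ b)) p a).1, (modelA (decide (Conn ends x a₁ a₂)) (decide (Conn ends x a₁ a₃)) (decide (Conn ends x a₁ b)) (decide (Conn ends x a₂ a₃)) (decide (Conn ends x a₂ b)) (decide (Conn ends x a₃ b)) p a).2.1, (modelA (decide (Conn ends x a₁ a₂)) (decide (Conn ends x a₁ a₃)) (decide (Conn ends x a₁ b)) (decide (Conn ends x a₂ a₃)) (decide (Conn ends x a₂ b)) (decide (Conn ends x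 a₃ b)) p a).2.2.1, (modelA (decide (Conn ends x a₁ a₂)) (decide (Conn ends x a₁ a₃)) (decide (Conn ends x a₁ b)) (decide (Conn ends x a₂ a₃)) (decide (Conn ends x a₂ b)) (decide (Conn ends x a₃ b)) p a).2.2.2.2.2.1, (modelA (decide (Conn ends x a₁ a₂)) (decide (Conn ends x a₁ a₃)) (decide (Conn ends x a₁ b)) (decide (Conn ends x a₂ a₃)) (decide (Conn ends x a₂ b)) (decide (Conn ends x a₃ b)) p a).2.2.2.2.2.2, (modelA (decide (Conn ends x a₁ a₂)) (decide (Conn ends x a₁ a₃)) (decide (Conn ends x a₁ b)) (decide (Conn ends x a₂ a₃)) (decide (Conn ends x a₂ b)) (decide (Conn ends x a₃ b)) p a).2.2.2.1, (modelA (decide (Conn ends x a₁ a₂)) (decide (Conn ends x a₁ a₃)) (decide (Conn ends x a₁ b)) (decide (Conn ends x a₂ a₃)) (decide (Conn ends x a₂ b)) (decide (Conn ends x a₃ b)) p a).2.2.2.2.1)) && (decide (Conn ends x a₃ b) || (p && a && (decide (Conn ends x a₁ a₃) || decide (Conn ends x a₃ b))))) || ((St.H3 ((modelA (decide (Conn ends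 x a₁ a₂)) (decide (Conn ends x a₁ a₃)) (decide (Conn ends x a₁ b)) (decide (Conn ends x a₂ a₃)) (decide (Conn ends x a₂ b)) (decide (Conn ends x a₃ b)) p a).1, (modelA (decide (Conn ends x a₁ a₂)) (decide (Conn ends x a₁ a₃)) (decide (Conn ends x a₁ b)) (decide (Conn ends x a₂ a₃)) (decide (Conn ends x a₂ b)) (decide (Conn ends x a₃ b)) p a).2.1, (modelA (decide (Conn ends x a₁ a₂)) (decide (Conn ends x a₁ a₃)) (decide (Conn ends x a₁ b)) (decide (Conn ends x a₂ a₃)) (decide (Conn ends x a₂ b)) (decide (Conn ends x a₃ b)) p a).2.2.1, (modelA (decide (Conn ends x a₁ a₂)) (decide (Conn ends x a₁ a₃)) (decide (Conn ends x a₁ b)) (decide (Conn ends x a₂ a₃)) (decide (Conn ends x a₂ b)) (decide (Conn ends x a₃ b)) p a).2.2.2.2.2.1, (modelA (decide (Conn ends x a₁ a₂)) (decide (Conn ends x a₁ a₃)) (decide (Conn ends x a₁ b)) (decide (Conn ends x a₂ a₃)) (decide (Conn ends x a₂ b)) (decide (Conn ends x a₃ b)) p a).2.2.2.2.2.2, (modelA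 (decide (Conn ends x a₁ a₂)) (decide (Conn ends x a₁ a₃)) (decide (Conn ends x a₁ b)) (decide (Conn ends x a₂ a₃)) (decide (Conn ends x a₂ b)) (decide (Conn ends x a₃ b)) p a).2.2.2.1, (modelA (decide (Conn ends x a₁ a₂)) (decide (Conn ends x a₁ a₃)) (decide (Conn ends x a₁ b)) (decide (Conn ends x a₂ a₃)) (decide (Conn ends x a₂ b)) (decide (Conn ends x a₃ b)) p a).2.2.2.2.1)) && ((p && (St.Lb ((modelA (decide (Conn ends x a₁ a₂)) (decide (Conn ends x a₁ a₃)) (decide (Conn ends x a₁ b)) (decide (Conn ends x a₂ a₃)) (decide (Conn ends x a₂ b)) (decide (Conn ends x a₃ b)) p a).1, (modelA (decide (Conn ends x a₁ a₂)) (decide (Conn ends x a₁ a₃)) (decide (Conn ends x a₁ b)) (decide (Conn ends x a₂ a₃)) (decide (Conn ends x a₂ b)) (decide (Conn ends x a₃ b)) p a).2.1, (modelA (decide (Conn ends x a₁ a₂)) (decide (Conn ends x a₁ a₃)) (decide (Conn ends x a₁ b)) (decide (Conn ends x a₂ a₃)) (decide (Conn ends x a₂ b)) (decide (Conn ends x a₃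 b)) p a).2.2.1, (modelA (decide (Conn ends x a₁ a₂)) (decide (Conn ends x a₁ a₃)) (decide (Conn ends x a₁ b)) (decide (Conn ends x a₂ a₃)) (decide (Conn ends x a₂ b)) (decide (Conn ends x a₃ b)) p a).2.2.2.2.2.1, (modelA (decide (Conn ends x a₁ a₂)) (decide (Conn ends x a₁ a₃)) (decide (Conn ends x a₁ b)) (decide (Conn ends x a₂ a₃)) (decide (Conn ends x a₂ b)) (decide (Conn ends x a₃ b)) p a).2.2.2.2.2.2, (modelA (decide (Conn ends x a₁ a₂)) (decide (Conn ends x a₁ a₃)) (decide (Conn ends x a₁ b)) (decide (Conn ends x a₂ a₃)) (decide (Conn ends x a₂ b)) (decide (Conn ends x a₃ b)) p a).2.2.2.1, (modelA (decide (Conn ends x a₁ a₂)) (decide (Conn ends x a₁ a₃)) (decide (Conn ends x a₁ b)) (decide (Conn ends x a₂ a₃)) (decide (Conn ends x a₂ b)) (decide (Conn ends x a₃ b)) p a).2.2.2.2.1))) || a)), (St.L3 ((modelA (decide (Conn ends x a₁ a₂)) (decide (Conn ends x a₁ a₃)) (decide (Conn ends x a₁ b)) (decide (Conn ends x a₂ a₃))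 (decide (Conn ends x a₂ b)) (decide (Conn ends x a₃ b)) p a).1, (modelA (decide (Conn ends x a₁ a₂)) (decide (Conn ends x a₁ a₃)) (decide (Conn ends x a₁ b)) (decide (Conn ends x a₂ a₃)) (decide (Conn ends x a₂ b)) (decide (Conn ends x a₃ b)) p a).2.1, (modelA (decide (Conn ends x a₁ a₂)) (decide (Conn ends x a₁ a₃)) (decide (Conn ends x a₁ b)) (decide (Conn ends x a₂ a₃)) (decide (Conn ends x a₂ b)) (decide (Conn ends x a₃ b)) p a).2.2.1, (modelA (decide (Conn ends x a₁ a₂)) (decide (Conn ends x a₁ a₃)) (decide (Conn ends x a₁ b)) (decide (Conn ends x a₂ a₃)) (decide (Conn ends x a₂ b)) (decide (Conn ends x a₃ b)) p a).2.2.2.2.2.1, (modelA (decide (Conn ends x a₁ a₂)) (decide (Conn ends x a₁ a₃)) (decide (Conn ends x a₁ b)) (decide (Conn ends x a₂ a₃)) (decide (Conn ends x a₂ b)) (decide (Conn ends x a₃ b)) p a).2.2.2.2.2.2, (modelA (decide (Conn ends x a₁ a₂)) (decide (Conn ends x a₁ a₃)) (decide (Conn ends x a₁ b)) (decide (Conn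 ends x a₂ a₃)) (decide (Conn ends x a₂ b)) (decide (Conn ends x a₃ b)) p a).2.2.2.1, (modelA (decide (Conn ends x a₁ a₂)) (decide (Conn ends x a₁ a₃)) (decide (Conn ends x a₁ b)) (decide (Conn ends x a₂ a₃)) (decide (Conn ends x a₂ b)) (decide (Conn ends x a₃ b)) p a).2.2.2.2.1)) || (St.Lo ((modelA (decide (Conn ends x a₁ a₂)) (decide (Conn ends x a₁ a₃)) (decide (Conn ends x a₁ b)) (decide (Conn ends x a₂ a₃)) (decide (Conn ends x a₂ b)) (decide (Conn ends x a₃ b)) p a).1, (modelA (decide (Conn ends x a₁ a₂)) (decide (Conn ends x a₁ a₃)) (decide (Conn ends x a₁ b)) (decide (Conn ends x a₂ a₃)) (decide (Conn ends x a₂ b)) (decide (Conn ends x a₃ b)) p a).2.1, (modelA (decide (Conn ends x a₁ a₂)) (decide (Conn ends x a₁ a₃)) (decide (Conn ends x a₁ b)) (decide (Conn ends x a₂ a₃)) (decide (Conn ends x a₂ b)) (decide (Conn ends x a₃ b)) p a).2.2.1, (modelA (decide (Conn ends x a₁ a₂)) (decide (Conn ends x a₁ a₃)) (decide (Conn ends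 x a₁ b)) (decide (Conn ends x a₂ a₃)) (decide (Conn ends x a₂ b)) (decide (Conn ends x a₃ b)) p a).2.2.2.2.2.1, (modelA (decide (Conn ends x a₁ a₂)) (decide (Conn ends x a₁ a₃)) (decide (Conn ends x a₁ b)) (decide (Conn ends x a₂ a₃)) (decide (Conn ends x a₂ b)) (decide (Conn ends x a₃ b)) p a).2.2.2.2.2.2, (modelA (decide (Conn ends x a₁ a₂)) (decide (Conn ends x a₁ a₃)) (decide (Conn ends x a₁ b)) (decide (Conn ends x a₂ a₃)) (decide (Conn ends x a₂ b)) (decide (Conn ends x a₃ b)) p a).2.2.2.1, (modelA (decide (Conn ends x a₁ a₂)) (decide (Conn ends x a₁ a₃)) (decide (Conn ends x a₁ b)) (decide (Conn ends x a₂ a₃)) (decide (Conn ends x a₂ b)) (decide (Conn ends x a₃ b)) p a).2.2.2.2.1)), (St.H3 ((modelA (decide (Conn ends x a₁ a₂)) (decide (Conn ends x a₁ a₃)) (decide (Conn ends x a₁ b)) (decide (Conn ends x a₂ a₃)) (decide (Conn ends x a₂ b)) (decide (Conn ends x a₃ b)) p a).1, (modelA (decide (Conn ends x a₁ a₂)) (decide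 (Conn ends x a₁ a₃)) (decide (Conn ends x a₁ b)) (decide (Conn ends x a₂ a₃)) (decide (Conn ends x a₂ b)) (decide (Conn ends x a₃ b)) p a).2.1, (modelA (decide (Conn ends x a₁ a₂)) (decide (Conn ends x a₁ a₃)) (decide (Conn ends x a₁ b)) (decide (Conn ends x a₂ a₃)) (decide (Conn ends x a₂ b)) (decide (Conn ends x a₃ b)) p a).2.2.1, (modelA (decide (Conn ends x a₁ a₂)) (decide (Conn ends x a₁ a₃)) (decide (Conn ends x a₁ b)) (decide (Conn ends x a₂ a₃)) (decide (Conn ends x a₂ b)) (decide (Conn ends x a₃ b)) p a).2.2.2.2.2.1, (modelA (decide (Conn ends x a₁ a₂)) (decide (Conn ends x a₁ a₃)) (decide (Conn ends x a₁ b)) (decide (Conn ends x a₂ a₃)) (decide (Conn ends x a₂ b)) (decide (Conn ends x a₃ b)) p a).2.2.2.2.2.2, (modelA (decide (Conn ends x a₁ a₂)) (decide (Conn ends x a₁ a₃)) (decide (Conn ends x a₁ b)) (decide (Conn ends x a₂ a₃)) (decide (Conn ends x a₂ b)) (decide (Conn ends x a₃ b)) p a).2.2.2.1, (modelA (decide (Conn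 ends x a₁ a₂)) (decide (Conn ends x a₁ a₃)) (decide (Conn ends x a₁ b)) (decide (Conn ends x a₂ a₃)) (decide (Conn ends x a₂ b)) (decide (Conn ends x a₃ b)) p a).2.2.2.2.1)) || (St.Ho ((modelA (decide (Conn ends x a₁ a₂)) (decide (Conn ends x a₁ a₃)) (decide (Conn ends x a₁ b)) (decide (Conn ends x a₂ a₃)) (decide (Conn ends x a₂ b)) (decide (Conn ends x a₃ b)) p a).1, (modelA (decide (Conn ends x a₁ a₂)) (decide (Conn ends x a₁ a₃)) (decide (Conn ends x a₁ b)) (decide (Conn ends x a₂ a₃)) (decide (Conn ends x a₂ b)) (decide (Conn ends x a₃ b)) p a).2.1, (modelA (decide (Conn ends x a₁ a₂)) (decide (Conn ends x a₁ a₃)) (decide (Conn ends x a₁ b)) (decide (Conn ends x a₂ a₃)) (decide (Conn ends x a₂ b)) (decide (Conn ends x a₃ b)) p a).2.2.1, (modelA (decide (Conn ends x a₁ a₂)) (decide (Conn ends x a₁ a₃)) (decide (Conn ends x a₁ b)) (decide (Conn ends x a₂ a₃)) (decide (Conn ends x a₂ b)) (decide (Conn ends x a₃ b)) p a).2.2.2.2.2.1,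 (modelA (decide (Conn ends x a₁ a₂)) (decide (Conn ends x a₁ a₃)) (decide (Conn ends x a₁ b)) (decide (Conn ends x a₂ a₃)) (decide (Conn ends x a₂ b)) (decide (Conn ends x a₃ b)) p a).2.2.2.2.2.2, (modelA (decide (Conn ends x a₁ a₂)) (decide (Conn ends x a₁ a₃)) (decide (Conn ends x a₁ b)) (decide (Conn ends x a₂ a₃)) (decide (Conn ends x a₂ b)) (decide (Conn ends x a₃ b)) p a).2.2.2.1, (modelA (decide (Conn ends x a₁ a₂)) (decide (Conn ends x a₁ a₃)) (decide (Conn ends x a₁ b)) (decide (Conn ends x a₂ a₃)) (decide (Conn ends x a₂ b)) (decide (Conn ends x a₃ b)) p a).2.2.2.2.1))) else ((modelA (decide (Conn ends x a₁ a₂)) (decide (Conn ends x a₁ a₃)) (decide (Conn ends x a₁ b)) (decide (Conn ends x a₂ a₃)) (decide (Conn ends x a₂ b)) (decide (Conn ends x a₃ b)) p a).1, (modelA (decide (Conn ends x a₁ a₂)) (decide (Conn ends x a₁ a₃)) (decide (Conn ends x a₁ b)) (decide (Conn ends x a₂ a₃)) (decide (Conn ends x a₂ b)) (decide (Conn ends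 x a₃ b)) p a).2.1, (modelA (decide (Conn ends x a₁ a₂)) (decide (Conn ends x a₁ a₃)) (decide (Conn ends x a₁ b)) (decide (Conn ends x a₂ a₃)) (decide (Conn ends x a₂ b)) (decide (Conn ends x a₃ b)) p a).2.2.1, (modelA (decide (Conn ends x a₁ a₂)) (decide (Conn ends x a₁ a₃)) (decide (Conn ends x a₁ b)) (decide (Conn ends x a₂ a₃)) (decide (Conn ends x a₂ b)) (decide (Conn ends x a₃ b)) p a).2.2.2.2.2.1, (modelA (decide (Conn ends x a₁ a₂)) (decide (Conn ends x a₁ a₃)) (decide (Conn ends x a₁ b)) (decide (Conn ends x a₂ a₃)) (decide (Conn ends x a₂ b)) (decide (Conn ends x a₃ b)) p a).2.2.2.2.2.2, (modelA (decide (Conn ends x a₁ a₂)) (decide (Conn ends x a₁ a₃)) (decide (Conn ends x a₁ b)) (decide (Conn ends x a₂ a₃)) (decide (Conn ends x a₂ b)) (decide (Conn ends x a₃ b)) p a).2.2.2.1, (modelA (decide (Conn ends x a₁ a₂)) (decide (Conn ends x a₁ a₃)) (decide (Conn ends x a₁ b)) (decide (Conn ends x a₂ a₃)) (decide (Conn ends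 x a₂ b)) (decide (Conn ends x a₃ b)) p a).2.2.2.2.1)) := by
  have hother' : ∀ e', e' ≠ e → e' ≠ f → o ∈ ends e' → x e' = false := fun e' h1 h2 ho' => by
    by_cases h3 : e' = g
    · rw [h3]; exact hxg
    · exact hother e' h1 h2 h3 ho'
  set x₁ := Function.update (Function.update x e p) f a with hx₁
  have ux : Function.update (Function.update x e false) f false = x := by
    funext e'
    by_cases h1 : e' = f
    · subst h1
      rw [Function.update_self, hxf]
    · rw [Function.update_of_ne h1]
      by_cases h2 : e' = e
      · subst h2
        rw [Function.update_self, hxe]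
      · rw [Function.update_of_ne h2]
  have hC : st ends o a₁ a₂ a₃ b x₁ = ((modelA (decide (Conn ends x a₁ a₂)) (decide (Conn ends x a₁ a₃)) (decide (Conn ends x a₁ b)) (decide (Conn ends x a₂ a₃)) (decide (Conn ends x a₂ b)) (decide (Conn ends x a₃ b)) p a).1, (modelA (decide (Conn ends x a₁ a₂)) (decide (Conn ends x a₁ a₃)) (decide (Conn ends x a₁ b)) (decide (Conn ends x a₂ a₃)) (decide (Conn ends x a₂ b)) (decide (Conn ends x a₃ b)) p a).2.1, (modelA (decide (Conn ends x a₁ a₂)) (decide (Conn ends x a₁ a₃)) (decide (Conn ends x a₁ b)) (decide (Conn ends x a₂ a₃)) (decide (Conn ends x a₂ b)) (decide (Conn ends x a₃ b)) p a).2.2.1, (modelA (decide (Conn ends x a₁ a₂)) (decide (Conn ends x a₁ a₃)) (decide (Conn ends x a₁ b)) (decide (Conn ends x a₂ a₃)) (decide (Conn ends x a₂ b)) (decide (Conn ends x a₃ b)) p a).2.2.2.2.2.1, (modelA (decide (Conn ends x a₁ a₂)) (decide (Conn ends x a₁ a₃)) (decide (Conn ends x a₁ b)) (decide (Conn ends x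 a₂ a₃)) (decide (Conn ends x a₂ b)) (decide (Conn ends x a₃ b)) p a).2.2.2.2.2.2, (modelA (decide (Conn ends x a₁ a₂)) (decide (Conn ends x a₁ a₃)) (decide (Conn ends x a₁ b)) (decide (Conn ends x a₂ a₃)) (decide (Conn ends x a₂ b)) (decide (Conn ends x a₃ b)) p a).2.2.2.1, (modelA (decide (Conn ends x a₁ a₂)) (decide (Conn ends x a₁ a₃)) (decide (Conn ends x a₁ b)) (decide (Conn ends x a₂ a₃)) (decide (Conn ends x a₂ b)) (decide (Conn ends x a₃ b)) p a).2.2.2.2.1) := by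
    rw [st_swap_b3 ends o a₁ a₂ a₃ b]
    have h := st_modelA ends o a₁ a₂ b a₃ hef he hf ho1 ho2 hob ho3 x hother' p a
    rw [ux] at h
    rw [h]
  set mc : St := ((modelA (decide (Conn ends x a₁ a₂)) (decide (Conn ends x a₁ a₃)) (decide (Conn ends x a₁ b)) (decide (Conn ends x a₂ a₃)) (decide (Conn ends x a₂ b)) (decide (Conn ends x a₃ b)) p a).1, (modelA (decide (Conn ends x a₁ a₂)) (decide (Conn ends x a₁ a₃)) (decide (Conn ends x a₁ b)) (decide (Conn ends x a₂ a₃)) (decide (Conn ends x a₂ b)) (decide (Conn ends x a₃ b)) p a).2.1, (modelA (decide (Conn ends x a₁ a₂)) (decide (Conn ends x a₁ a₃)) (decide (Conn ends x a₁ b)) (decide (Conn ends x a₂ a₃)) (decide (Conn ends x a₂ b)) (decide (Conn ends x a₃ b)) p a).2.2.1, (modelA (decide (Conn ends x a₁ a₂)) (decide (Conn ends x a₁ a₃)) (decide (Conn ends x a₁ b)) (decide (Conn ends x a₂ a₃)) (decide (Conn ends x a₂ b)) (decide (Conn ends x a₃ b)) p a).2.2.2.2.2.1, (modelA (decide (Conn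 ends x a₁ a₂)) (decide (Conn ends x a₁ a₃)) (decide (Conn ends x a₁ b)) (decide (Conn ends x a₂ a₃)) (decide (Conn ends x a₂ b)) (decide (Conn ends x a₃ b)) p a).2.2.2.2.2.2, (modelA (decide (Conn ends x a₁ a₂)) (decide (Conn ends x a₁ a₃)) (decide (Conn ends x a₁ b)) (decide (Conn ends x a₂ a₃)) (decide (Conn ends x a₂ b)) (decide (Conn ends x a₃ b)) p a).2.2.2.1, (modelA (decide (Conn ends x a₁ a₂)) (decide (Conn ends x a₁ a₃)) (decide (Conn ends x a₁ b)) (decide (Conn ends x a₂ a₃)) (decide (Conn ends x a₂ b)) (decide (Conn ends x a₃ b)) p a).2.2.2.2.1) with hmc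
  clear_value mc
  have hx₁g : x₁ g = false := by
    rw [hx₁, Function.update_of_ne hfg.symm, Function.update_of_ne heg.symm, hxg]
  cases u
  · have h0 : Function.update x₁ g false = x₁ := by
      rw [show (false : Bool) = x₁ g from hx₁g.symm, Function.update_eq_self]
    simp only [Bool.false_eq_true, if_false]
    rw [h0, hC]
  · simp only [if_true]
    have off := fun {s t : V} (hs : s ≠ o) (ht : t ≠ o) =>
      conn_off_mid hef he hf ho1 hob x hother' p a hs ht
    have mid := fun {s : V} (hs : s ≠ o) => conn_mid_iff hef he hf ho1 hob x hother' p a hs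
    rw [ux] at off
    have cq : Conn ends x₁ a₂ a₁ ↔ St.q' mc = true := by
      rw [← hC]; unfold st St.q'; simp only [decide_eq_true_eq]
    have cLo : Conn ends x₁ a₁ o ↔ St.Lo mc = true := by
      rw [← hC]; unfold st St.Lo; simp only [decide_eq_true_eq]
    have cHo : Conn ends x₁ a₂ o ↔ St.Ho mc = true := by
      rw [← hC]; unfold st St.Ho; simp only [decide_eq_true_eq]
    have cLb : Conn ends x₁ a₁ b ↔ St.Lb mc = true := by
      rw [← hC]; unfold st St.Lb; simp only [decide_eq_true_eq]
    have cHb : Conn ends x₁ a₂ b ↔ St.Hb mc = true := by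
      rw [← hC]; unfold st St.Hb; simp only [decide_eq_true_eq]
    have cL3 : Conn ends x₁ a₁ a₃ ↔ St.L3 mc = true := by
      rw [← hC]; unfold st St.L3; simp only [decide_eq_true_eq]
    have cH3 : Conn ends x₁ a₂ a₃ ↔ St.H3 mc = true := by
      rw [← hC]; unfold st St.H3; simp only [decide_eq_true_eq]
    -- the further connections: `a₃ ~ b` off the mark, `o ~ a₃` and `o ~ b` through the mark
    have c3b : Conn ends x₁ a₃ b ↔ (decide (Conn ends x a₃ b) ||
        (p && a && (decide (Conn ends x a₁ a₃) || decide (Conn ends x a₃ b)))) = true := by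
      rw [off ho3.symm hob.symm]
      simp only [Bool.or_eq_true, Bool.and_eq_true, decide_eq_true_eq]
      constructor
      · rintro (h | ⟨hm, h1, _⟩)
        · exact Or.inl h
        · refine Or.inr ⟨hm, ?_⟩
          rcases h1 with h1 | h1
          · exact Or.inl (conn_symm h1)
          · exact Or.inr h1
      · rintro (h | ⟨hm, h1⟩)
        · exact Or.inl h
        · refine Or.inr ⟨hm, ?_, Or.inr (conn_refl ends x b)⟩
          rcases h1 with h1 | h1
          · exact Or.inl (conn_symm h1)
          · exact Or.inr h1
    have cO3 : Conn ends x₁ o a₃ ↔ (p = true ∧ Conn ends x₁ a₁ a₃) ∨ (a = true ∧ Conn ends x₁ a₃ b) := by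
      have h := mid ho3.symm
      constructor
      · intro h'
        rcases h.1 (conn_symm h') with ⟨hp, h1⟩ | ⟨ha, h1⟩
        · exact Or.inl ⟨hp, conn_symm h1⟩
        · exact Or.inr ⟨ha, h1⟩
      · rintro (⟨hp, h1⟩ | ⟨ha, h1⟩)
        · exact conn_symm (h.2 (Or.inl ⟨hp, conn_symm h1⟩))
        · exact conn_symm (h.2 (Or.inr ⟨ha, h1⟩))
    have cOb : Conn ends x₁ o b ↔ ((p && St.Lb mc) || a) = true := by
      have h := mid hob.symm
      simp only [Bool.or_eq_true, Bool.and_eq_true]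
      rw [← cLb]
      constructor
      · intro h'
        rcases h.1 (conn_symm h') with ⟨hp, h1⟩ | ⟨ha, _⟩
        · exact Or.inl ⟨hp, conn_symm h1⟩
        · exact Or.inr ha
      · rintro (⟨hp, h1⟩ | ha)
        · exact conn_symm (h.2 (Or.inl ⟨hp, conn_symm h1⟩))
        · exact conn_symm (h.2 (Or.inr ⟨ha, conn_refl ends x₁ b⟩))
    have upd := fun (s t : V) => OneEdge.conn_update_true_iff hg x₁ s t
    have sym : ∀ s t : V, Conn ends x₁ s t ↔ Conn ends x₁ t s := fun s t => ⟨conn_symm, conn_symm⟩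
    have roo : Conn ends x₁ o o := conn_refl ends x₁ o
    have r33 : Conn ends x₁ a₃ a₃ := conn_refl ends x₁ a₃
    unfold st
    simp only [Prod.mk.injEq]
    refine ⟨?_, ?_, ?_, ?_, ?_, ?_, ?_⟩
    · apply Bool.eq_iff_iff.mpr
      simp only [decide_eq_true_eq]
      rw [upd, sym a₃ a₁, sym o a₁, cq, cHo, cL3, cH3, cLo]
      simp only [Bool.or_eq_true, Bool.and_eq_true]
      clear hmc hC off mid upd sym cq cLo cHo cLb cHb cL3 cH3 c3b cO3 cOb hother hother' ux hx₁ hx₁g roo r33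
      tauto
    · apply Bool.eq_iff_iff.mpr
      simp only [decide_eq_true_eq]
      rw [upd, cLo, sym a₃ o, cO3, cL3, c3b]
      simp only [roo, and_true, Bool.or_eq_true, Bool.and_eq_true, decide_eq_true_eq]
      clear hmc hC off mid upd sym cq cLo cHo cLb cHb cL3 cH3 c3b cO3 cOb hother hother' ux hx₁ hx₁g roo r33
      tauto
    · apply Bool.eq_iff_iff.mpr
      simp only [decide_eq_true_eq]
      rw [upd, cHo, sym a₃ o, cO3, cL3, c3b, cH3]
      simp only [roo, and_true, Bool.or_eq_true, Bool.and_eq_true, decide_eq_true_eq]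
      clear hmc hC off mid upd sym cq cLo cHo cLb cHb cL3 cH3 c3b cO3 cOb hother hother' ux hx₁ hx₁g roo r33
      tauto
    · apply Bool.eq_iff_iff.mpr
      simp only [decide_eq_true_eq]
      rw [upd, cLb, cLo, c3b, cL3, cOb]
      simp only [Bool.or_eq_true, Bool.and_eq_true, decide_eq_true_eq]
      clear hmc hC off mid upd sym cq cLo cHo cLb cHb cL3 cH3 c3b cO3 cOb hother hother' ux hx₁ hx₁g roo r33
      tauto
    · apply Bool.eq_iff_iff.mpr
      simp only [decide_eq_true_eq]
      rw [upd, cHb, cHo, c3b, cH3, cOb]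
      simp only [Bool.or_eq_true, Bool.and_eq_true, decide_eq_true_eq]
      clear hmc hC off mid upd sym cq cLo cHo cLb cHb cL3 cH3 c3b cO3 cOb hother hother' ux hx₁ hx₁g roo r33
      tauto
    · apply Bool.eq_iff_iff.mpr
      simp only [decide_eq_true_eq]
      rw [upd, cL3, cLo, cO3, cL3, c3b]
      simp only [r33, and_true, Bool.or_eq_true, Bool.and_eq_true, decide_eq_true_eq]
      clear hmc hC off mid upd sym cq cLo cHo cLb cHb cL3 cH3 c3b cO3 cOb hother hother' ux hx₁ hx₁g roo r33
      tauto
    · apply Bool.eq_iff_iff.mpr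
      simp only [decide_eq_true_eq]
      rw [upd, cH3, cHo, cO3, cL3, c3b]
      simp only [r33, and_true, Bool.or_eq_true, Bool.and_eq_true, decide_eq_true_eq]
      clear hmc hC off mid upd sym cq cLo cHo cLb cHb cL3 cH3 c3b cO3 cOb hother hother' ux hx₁ hx₁g roo r33
      tauto

end StateLemma

end MarkedSeries

end CovForm

end Summit.Ventures.PercRepro2
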